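import Mathlib.Analysis.Convex.Slope
import Summits.Ventures.CertifiedArithmetic.LowPrec.SRDoubleRoundingFormats
import Summits.Ventures.CertifiedArithmetic.LowPrec.SRTreeIntervals
import Summits.Ventures.CertifiedArithmetic.LowPrec.SRFaithful
import HarnessLib

/-!
# Double stochastic rounding never shrinks a convex risk (file XLII)

HONEST FRAMING: certified error envelopes and provably optimal rounding/accumulation schemes for
low-precision formats under stated cost models; every table by two implementations; no hardware or
vendor claims.

Files XL/XLI: SR into an intermediate `G` followed by SR into the target `F` is the SAME rounding
as one SR into `F` iff `F ⊆ G`.  This file orders the two roundings when they differ.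

* `le_step_of_convexOn` — JENSEN FOR ONE SR STEP: for `y` in the hull of `F` and `f` convex,
  `f y ≤ E f(SR_F(y))` (stochastic rounding never decreases a convex functional of the value).
* `chord_le_of_convexOn` — a convex function lies ABOVE the chord of a cell outside the cell;
  `mem_le_dn_or_up_le` — every point of `F` lies outside the open cell of `c`.
* `step_le_step_step_of_convexOn` — **CONVEX ORDER: if `c` is in the hull of `G` and both
  `G`-candidates of `c` are in the hull of `F` (neither step saturates), then for EVERY convex
  test function `E f(SR_F(c)) ≤ E f(SR_F(SR_G(c)))`** — every finite `F`, `G` over any linear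
  ordered field, no embedding hypothesis.  With `step_step_id` (same mean `c`) this says: the law
  of double SR is a mean-preserving spread of the law of single SR; in particular
  `var_single_le_var_double` — **double SR has at least the variance of single SR**, and likewise
  for every absolute central moment of even order, exponential moments, ….  Proof: single SR is
  the chord of `f` over the `F`-cell of `c` evaluated at `c` (file XL); the composite is an average
  of `f` over points of `F`, all outside the open cell, where `f` dominates the chord; and the
  average of the (affine) chord is its value at the mean `c`.
* Formats: `doubleSR_convex_le` — for formats `φ` (target) and `ψ` (intermediate) with
  `maxRat ψ ≤ maxRat φ`, or with `maxRat φ ∈ F_ψ`, and `|c|` within both ranges, double SR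
  dominates single SR in convex order; `var_single_le_var_double_format`.
* **Where unbiasedness of the composite BREAKS strictly inside both ranges**
  (`doubleSR_E2M3_via_E3M2_biased`, kernel): target E2M3 (`maxRat 15/2 ∉ F_E3M2`), intermediate
  E3M2, input `c = 29/4 ∈ F_E2M3` with `|c| < 15/2 < 28`: SR into E3M2 gives `7` or `8`, and
  `8` saturates to `15/2` in E2M3 — composite mean `57/8 ≠ 29/4` although single SR is exact.
  So the hull hypothesis on the `G`-candidates in `step_step_id` /
  `step_le_step_step_of_convexOn` is not an artefact: without it the composite is biased.
-/

namespace Summit.Ventures.CertifiedArithmetic.LowPrec.SR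

open Literature.ComputerArithmetic.ConnollyHighamMary2021
open Literature.ComputerArithmetic.FloatingPoint
open Finset
open Literature.ComputerArithmetic.FloatingPoint.MiniFloat

section Generic

variable {K : Type*} [Field K] [LinearOrder K] [IsStrictOrderedRing K]

/-- Monotonicity of one step through its two candidates only (generic field version). -/
private theorem step_mono_leaves (F : Finset K) (c : K) {f g : K → K}
    (hu : f (up F c) ≤ g (up F c)) (hd : f (dn F c) ≤ g (dn F c)) :
    step F c f ≤ step F c g := by
  unfold step
  have hp := pUp_nonneg F c
  have hq : 0 ≤ 1 - pUp F c := sub_nonneg.mpr (pUp_le_one F c)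
  exact add_le_add (mul_le_mul_of_nonneg_left hu hp) (mul_le_mul_of_nonneg_left hd hq)

/-- **JENSEN FOR ONE SR STEP**: for `y` in the hull and `f` convex, `f y ≤ E f(SR_F(y))` —
stochastic rounding never decreases (in expectation) a convex function of the value.
[folklore (two-point Jensen); SR form new here] -/
theorem le_step_of_convexOn {F : Finset K} {y : K} (hy : InHull F y) {f : K → K}
    (hf : ConvexOn K Set.univ f) : f y ≤ step F y f := by
  have hp := pUp_nonneg F y
  have hq : 0 ≤ 1 - pUp F y := sub_nonneg.mpr (pUp_le_one F y)
  have hmean : pUp F y * up F y + (1 - pUp F y) * dn F y = y := by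
    have h := step_id F y
    unfold step at h
    rw [clamp_eq_self hy] at h
    exact h
  have key := hf.2 (Set.mem_univ (up F y)) (Set.mem_univ (dn F y)) hp hq (by ring)
  simp only [smul_eq_mul] at key
  rw [hmean] at key
  unfold step
  exact key

/-- A convex function lies above the chord of `[d, u]` OUTSIDE the open interval `(d, u)`.
[Mathlib `ConvexOn.secant_mono_aux1`, rearranged] -/
theorem chord_le_of_convexOn {f : K → K} (hf : ConvexOn K Set.univ f) {d u w : K} (hdu : d < u)
    (hw : w ≤ d ∨ u ≤ w) : f d + (w - d) * ((f u - f d) / (u - d)) ≤ f w := by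
  have hud : 0 < u - d := sub_pos.mpr hdu
  have hm : (f u - f d) / (u - d) * (u - d) = f u - f d := div_mul_cancel₀ _ hud.ne'
  have key : (u - d) * (f d + (w - d) * ((f u - f d) / (u - d))) =
      (u - d) * f d + (w - d) * (f u - f d) := by
    rw [mul_add, show (u - d) * ((w - d) * ((f u - f d) / (u - d))) =
      (w - d) * ((f u - f d) / (u - d) * (u - d)) by ring, hm]
  refine le_of_mul_le_mul_left ?_ hud
  rw [key]
  rcases hw with hw | hw
  · rcases eq_or_lt_of_le hw with rfl | hw
    · simp
    · have h := hf.secant_mono_aux1 (Set.mem_univ w) (Set.mem_univ u) hw hdu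
      linarith
  · rcases eq_or_lt_of_le hw with rfl | hw
    · linarith
    · have h := hf.secant_mono_aux1 (Set.mem_univ d) (Set.mem_univ w) hdu hw
      linarith

omit [Field K] [IsStrictOrderedRing K] in
/-- Every point of `F` lies outside the open cell of `c`: `z ≤ ⌊c⌋` or `⌈c⌉ ≤ z`. -/
theorem mem_le_dn_or_up_le {F : Finset K} {c z : K} (hz : z ∈ F) :
    z ≤ dn F c ∨ up F c ≤ z := by
  rcases le_or_gt z (dn F c) with h | h
  · exact Or.inl h
  rcases le_or_gt (up F c) z with h' | h'
  · exact Or.inr h'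
  rcases eq_dn_or_up_of_mem_cell hz h.le h'.le with h1 | h1
  · exact absurd (h1 ▸ h) (lt_irrefl _)
  · exact absurd (h1 ▸ h') (lt_irrefl _)

omit [IsStrictOrderedRing K] [Field K] in
/-- If `c` is in the hull of `G` and both `G`-candidates of `c` are in the hull of `F`, then `c`
is in the hull of `F`. -/
theorem inHull_of_candidates {F G : Finset K} {c : K} (hG : InHull G c) (hd : InHull F (dn G c))
    (hu : InHull F (up G c)) : InHull F c := by
  have h1 : dn G c ≤ c := by simpa [clamp_eq_self hG] using dn_le_clamp G c
  have h2 : c ≤ up G c := by simpa [clamp_eq_self hG] using clamp_le_up G c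
  obtain ⟨⟨y, hy, hyd⟩, _⟩ := hd
  obtain ⟨_, ⟨z, hz, huz⟩⟩ := hu
  exact ⟨⟨y, hy, hyd.trans h1⟩, ⟨z, hz, h2.trans huz⟩⟩

/-- **DOUBLE SR DOMINATES SINGLE SR IN CONVEX ORDER.**  If `c` is in the hull of the intermediate
set `G` and both `G`-candidates of `c` lie in the hull of the target `F` (neither step
saturates), then for every convex test function `f`,
`E f(SR_F(c)) ≤ E f(SR_F(SR_G(c)))` — every finite `F`, `G`, no embedding hypothesis.
[new; contrast `step_step_of_subset` (equality when `F ⊆ G`)] -/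
theorem step_le_step_step_of_convexOn {F G : Finset K} (hF : F.Nonempty) {c : K}
    (hG : InHull G c) (hd : InHull F (dn G c)) (hu : InHull F (up G c)) {f : K → K}
    (hf : ConvexOn K Set.univ f) : step F c f ≤ step G c (fun y => step F y f) := by
  have hc : InHull F c := inHull_of_candidates hG hd hu
  have h1 : dn F c ≤ c := by simpa [clamp_eq_self hc] using dn_le_clamp F c
  have h2 : c ≤ up F c := by simpa [clamp_eq_self hc] using clamp_le_up F c
  rcases eq_or_lt_of_le (h1.trans h2) with heq | hlt
  · -- `c ∈ F`: single SR is exact, `E f = f c`; Jensen twice for the composite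
    have hdc : dn F c = c := le_antisymm h1 (heq ▸ h2)
    have huc : up F c = c := le_antisymm (heq ▸ h1) h2
    have hs : step F c f = f c := by unfold step; rw [hdc, huc]; ring
    rw [hs]
    calc f c ≤ step G c f := le_step_of_convexOn hG hf
      _ ≤ step G c (fun y => step F y f) :=
        step_mono_leaves G c (le_step_of_convexOn hu hf) (le_step_of_convexOn hd hf)
  · -- `⌊c⌋ < ⌈c⌉`: single SR is the chord `ℓ` at `c`; `f ≥ ℓ` on `F`; the composite
    -- averages `f` over points of `F`, and the average of `ℓ` is `ℓ c`
    set d := dn F c with hd_def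
    set u := up F c with hu_def
    set m := (f u - f d) / (u - d) with hm_def
    have hsingle : step F c f = f d + (c - d) * m := step_eq_affine hc h1 h2 f
    have hG_aff : step G c (fun y => f d + (y - d) * m) = f d + (c - d) * m :=
      step_affine_of_inHull hG (f d) d m
    have hdom : ∀ z ∈ F, f d + (z - d) * m ≤ f z :=
      fun z hz => chord_le_of_convexOn hf hlt (mem_le_dn_or_up_le hz)
    have hleaf : ∀ y, InHull F y → f d + (y - d) * m ≤ step F y f := fun y hy => by
      rw [← step_affine_of_inHull hy (f d) d m]
      exact step_mono_leaves F y (hdom _ (up_mem hF y)) (hdom _ (dn_mem hF y))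
    rw [hsingle, ← hG_aff]
    exact step_mono_leaves G c (hleaf _ hu) (hleaf _ hd)

/-- The quadratic test `(· − a)²` is convex. -/
theorem convexOn_sq_sub (a : K) : ConvexOn K Set.univ (fun z => (z - a) ^ 2) := by
  refine ⟨convex_univ, fun x _ y _ p q hp hq hpq => ?_⟩
  simp only [smul_eq_mul]
  have hq' : q = 1 - p := by rw [← hpq]; ring
  subst hq'
  nlinarith [mul_nonneg hp hq, sq_nonneg (x - y)]

/-- **DOUBLE SR HAS AT LEAST THE VARIANCE OF SINGLE SR** (both have mean `c` under the same
hypotheses, `step_id` / `step_step_id`): `E (SR_F(c) − c)² ≤ E (SR_F(SR_G(c)) − c)²`. -/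
theorem var_single_le_var_double {F G : Finset K} (hF : F.Nonempty) {c : K} (hG : InHull G c)
    (hd : InHull F (dn G c)) (hu : InHull F (up G c)) :
    step F c (fun z => (z - c) ^ 2) ≤ step G c (fun y => step F y fun z => (z - c) ^ 2) :=
  step_le_step_step_of_convexOn hF hG hd hu (convexOn_sq_sub c)

end Generic

/-! ### Formats -/

/-- `|c| ≤ maxRat φ` puts `c` in the hull of `F_φ`. -/
private theorem inHull_of_abs_le {φ : Format} {c : ℚ} (h : |c| ≤ φ.maxRat) :
    InHull (valueSet φ) c :=
  (valueSet_inHull_iff φ c).mpr h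

/-- Hull hypothesis, range form: if the intermediate range is inside the target range
(`maxRat ψ ≤ maxRat φ`) then every `ψ`-candidate is in the hull of `φ`. -/
theorem candidates_inHull_of_maxRat_le {φ ψ : Format} (hM : ψ.maxRat ≤ φ.maxRat) (c : ℚ) :
    InHull (valueSet φ) (dn (valueSet ψ) c) ∧ InHull (valueSet φ) (up (valueSet ψ) c) :=
  ⟨inHull_of_abs_le ((abs_le_maxRat_of_mem_valueSet (dn_mem (valueSet_nonempty ψ) c)).trans hM),
   inHull_of_abs_le ((abs_le_maxRat_of_mem_valueSet (up_mem (valueSet_nonempty ψ) c)).trans hM)⟩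

/-- Hull hypothesis, top-value form: if `maxRat φ` is a `ψ`-value then for `|c| ≤ maxRat φ`
both `ψ`-candidates of `c` are in the hull of `φ` (squeezed by `±maxRat φ ∈ F_ψ`). -/
theorem candidates_inHull_of_maxRat_mem {φ ψ : Format} (hM : φ.maxRat ∈ valueSet ψ) {c : ℚ}
    (hc : |c| ≤ φ.maxRat) :
    InHull (valueSet φ) (dn (valueSet ψ) c) ∧ InHull (valueSet φ) (up (valueSet ψ) c) := by
  have hcψ : InHull (valueSet ψ) c :=
    ⟨⟨-φ.maxRat, neg_mem_valueSet hM, (abs_le.mp hc).1⟩,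
      ⟨φ.maxRat, hM, (abs_le.mp hc).2⟩⟩
  have h1 : dn (valueSet ψ) c ≤ c := by
    simpa [clamp_eq_self hcψ] using dn_le_clamp (valueSet ψ) c
  have h2 : c ≤ up (valueSet ψ) c := by
    simpa [clamp_eq_self hcψ] using clamp_le_up (valueSet ψ) c
  have h3 : -φ.maxRat ≤ dn (valueSet ψ) c := by
    have := le_dn_of_mem (neg_mem_valueSet hM) (abs_le.mp hc).1
    simpa [clamp_eq_self hcψ] using this
  have h4 : up (valueSet ψ) c ≤ φ.maxRat := by
    have := up_le_of_mem hM (abs_le.mp hc).2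
    simpa [clamp_eq_self hcψ] using this
  exact ⟨inHull_of_abs_le (abs_le.mpr ⟨h3, by linarith⟩),
    inHull_of_abs_le (abs_le.mpr ⟨by linarith, h4⟩)⟩

/-- **FORMATS: double SR `ψ` then `φ` dominates single SR into `φ` in convex order** for every
input with `|c| ≤ maxRat ψ` whose `ψ`-candidates stay in the range of `φ` — in particular
whenever `maxRat ψ ≤ maxRat φ`, or `maxRat φ ∈ F_ψ` and `|c| ≤ maxRat φ`
(`candidates_inHull_of_maxRat_le`, `candidates_inHull_of_maxRat_mem`). -/
theorem doubleSR_convex_le {φ ψ : Format} {c : ℚ} (hc : |c| ≤ ψ.maxRat)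
    (hcand : InHull (valueSet φ) (dn (valueSet ψ) c) ∧
      InHull (valueSet φ) (up (valueSet ψ) c))
    {f : ℚ → ℚ} (hf : ConvexOn ℚ Set.univ f) :
    step (valueSet φ) c f ≤ step (valueSet ψ) c (fun y => step (valueSet φ) y f) :=
  step_le_step_step_of_convexOn (valueSet_nonempty φ) (inHull_of_abs_le hc) hcand.1 hcand.2 hf

/-- Variance form on formats with nested ranges (`maxRat ψ ≤ maxRat φ`, e.g. E3M2 via E2M3,
binary32 via any FP8): for `|c| ≤ maxRat ψ` double SR has mean `c` and AT LEAST the variance of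
single SR. -/
theorem var_single_le_var_double_format {φ ψ : Format} (hM : ψ.maxRat ≤ φ.maxRat) {c : ℚ}
    (hc : |c| ≤ ψ.maxRat) :
    step (valueSet ψ) c (fun y => step (valueSet φ) y fun t => t) = c ∧
    step (valueSet φ) c (fun z => (z - c) ^ 2)
      ≤ step (valueSet ψ) c (fun y => step (valueSet φ) y fun z => (z - c) ^ 2) :=
  have h := candidates_inHull_of_maxRat_le hM c
  ⟨step_step_id (inHull_of_abs_le hc) h.1 h.2,
   doubleSR_convex_le hc h (convexOn_sq_sub c)⟩

/-- **WHERE IT BREAKS: the composite is BIASED strictly inside both ranges when the target's top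
value is not an intermediate value.**  Target E2M3 (`maxRat = 15/2 ∉ F_E3M2`), intermediate
E3M2 (`maxRat = 28`), input `c = 29/4 ∈ F_E2M3`, `|c| < 15/2`: single SR is exact; SR into E3M2
yields `7` (prob. `3/4`) or `8` (prob. `1/4`), and `8` saturates to `15/2` in E2M3: composite mean
`57/8 ≠ 29/4`, second moment about `c` `1/16` (kernel, literal FP6 tables). -/
theorem doubleSR_E2M3_via_E3M2_biased :
    step Formats.e2m3 (29 / 4 : ℚ) (fun t => t) = 29 / 4 ∧
    step Formats.e3m2 (29 / 4 : ℚ) (fun y => step Formats.e2m3 y fun t => t) = 57 / 8 ∧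
    step Formats.e3m2 (29 / 4 : ℚ) (fun y => step Formats.e2m3 y fun z => (z - 29 / 4) ^ 2)
      = 1 / 16 := by
  refine ⟨by decide +kernel, by decide +kernel, by decide +kernel⟩

end Summit.Ventures.CertifiedArithmetic.LowPrec.SR
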